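import Mathlib.Algebra.Group.Submonoid.Operations
import Mathlib.Algebra.Group.Units.Hom
import Mathlib.Algebra.Group.Units.Equiv
import Literature.IUT.HodgeArakelov.TemperedThetaMonoidsProofs
import Literature.IUT.HodgeArakelov.AbsTopInterfaces

/-!
# [IUTchII] §3, Prop 3.1 (ii) — proof companion 2: the constant monoid `Ψ_cns(M^Θ_*) = M_TM(M^Θ_*)` is
# "naturally isomorphic to `O^▷_{F̄_v}` [cf. Example 1.8, (ii)]"

S. Mochizuki, *Inter-universal Teichmüller theory II*, §3 "Tempered Gaussian Frobenioids" (kurims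
Dec-2020 manuscript), Proposition 3.1 (ii) p. 88 l.2–9 [cite: Mochizuki2012, Prop 3.1 (ii) p.88]:
"By applying the cyclotomic rigidity isomorphisms of Corollaries 2.8, (i); 2.9, and considering the
inverse image of `ℤ ⊆ Ẑ` via the surjection of Remark 1.11.5, (i), applied to `G_v(M^Θ_*)`
(`= G_v(Π_X(M^Θ_*))`) [cf. the notation of Corollary 2.5, (i)], one obtains a functorial algorithm
`M^Θ_* ↦ Ψ_cns(M^Θ_*) := M_TM(M^Θ_*) ⊆ lim_J H¹(Π_Ÿ(M^Θ_*)|_J, Π_μ(M^Θ_*))` [where `J` is as in (i)] for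
constructing a 'monoid of constants' — i.e., which is naturally isomorphic to `O^▷_{F̄_v}` [cf. Example
1.8, (ii)] — equipped with a natural conjugation action by `Π_X(M^Θ_*)`." Printed proof: "follow[s]
immediately from the definitions and the references quoted". Claim key DISPUTED (D-0012).

PROOF-ONLY companion (abc-iut cell, D-0067 wave 4, seat abc-iut-w4-d019; L6 discharge board row F2,
node IUTchII:Prop3.1(ii); `TemperedThetaMonoidsProofs.lean` (abc-iut-L6-d3) left exactly this clause
as a SLOT: "naturally isomorphic to `O^▷_{F̄_v}`: NEEDS the cyclotomic rigidity isomorphisms of Cors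
2.8 (i), 2.9"). Nothing here asserts a disputed claim or takes a side on [IUTchIII] Cor 3.12; no
definition, no new named fact: every declaration is a theorem about the TYPED objects on the two sides
of the printed sentence —

* the consumer side (abc-iut-L6-t2, `TemperedThetaMonoids.lean` p404874): the Prop 3.1 input record
  `ThetaEnvData E` over the acting group `Π_X(M^Θ_*)`, whose field `constants` / definition
  `constantMonoid` IS `Ψ_cns(M^Θ_*) := M_TM(M^Θ_*)` inside the ambient module
  `E.H = lim_J H¹(Π_Ÿ(M^Θ_*)|_J, Π_μ(M^Θ_*))`, with unit group `units = M^×_TM(M^Θ_*)` (`units_eq`) and the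
  conjugation action `conj`;
* the producer side (abc-iut-L6-t1, `AbsTopInterfaces.lean`): the output `(Π ↷ M_TM(Π))` of the
  [AbsTopIII] §3 algorithm `(*TM)` quoted by Example 1.8 (ii) — `AbsTopMonoids.MTM`, `actMTM` — for the
  isomorph `Π = Π_X(M^Θ_*)` of `Π^tp_{X̲̲_k}` (`Pc : IsoClass S.PiX`), the output `(G ↷ O^⊳(G))` of `(*⊳)`
  at the arithmetic quotient `G = Π/Δ = G_v(M^Θ_*)` — `Otri`, `actOtri`, "isomorphic to the MLF-Galois
  TM-pair determined by the natural action of `G_k` on the ind-topological monoid `O^▷_{k̄}`" (Example 1.8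
  (ii) p. 36–37; `k = F_v` here) — and the tautological isomorphism `(*TM⊳) (Π ↷ M_TM(Π)) ⥲
  (Π/Δ ↷ O^⊳(Π/Δ))|_Π` (`tauto`, `tauto_equivariant`; [AbsTopIII] Prop. 3.2 (iv)).

Between the two sides stands ONE homomorphism, carried as an explicit hypothesis of every theorem
(transport form, as in `ThetaValueOrbitsProofs.cor29i_transport`):
`κ : M_TM(Π_X(M^Θ_*)) →* lim_J H¹(Π_Ÿ(M^Θ_*)|_J, Π_μ(M^Θ_*))`, the composite of the Kummer map
`M_TM(Π) → lim_J H¹(Π|_J, μ_Ẑ(M_TM(Π)))` ([AbsTopIII] Prop. 3.2 (ii); abc-iut-L4-t2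
`MonoidKummerTheory.kummerLim`) with the isomorphism of direct limits of `H¹`'s induced by the
cyclotomic rigidity isomorphisms `μ_Ẑ(M_TM(Π)) ⥲ μ_Ẑ(G_v) ⥲ (l·Δ_Θ)(Π_v) ⥲ Π_μ(M^Θ_*)` of Corollary 1.11
(a), Corollary 2.9 and Corollary 2.8 (i) — "by applying the cyclotomic rigidity isomorphisms of
Corollaries 2.8, (i); 2.9". Its two printed properties are the hypotheses `hκ : Injective κ` (Kummer
theory of MLF's: `F̄_v^×` has no nontrivial divisible elements locally, i.e. `K^× ↪ (K^×)^∧` for every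
finite `K/F_v`; cf. Remark 1.11.5 (i) "the natural Kummer map `k^× ↪ H¹(G_k, μ_Ẑ(G_k))`",
`ValuationSurjection.kummer_injective` of `GaloisPairRigidity.lean`) and `hκeq` (`Π`-equivariance of
Kummer classes), and the printed DEFINITION `Ψ_cns(M^Θ_*) := M_TM(M^Θ_*)` is the hypothesis
`hcns : E.constantMonoid = MonoidHom.mrange κ`. The homomorphism `κ` itself is not constructible in
the tree today (abc-iut-L6-t1's `CohomologySystem` carries neither a `Π`-action nor Kummer maps — cf. the
docstring of `MuXmuDiagram` in `ConstantMultipleRigidity.lean`: "rests on the Kummer identification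
`M_TM(Π)^× ≅ M^×_TM(Π)`, [AbsTopIII] Prop. 3.2, which the cohomology interface does not carry"); this
is recorded on the cell's GAP-LEDGER (row G-w4d019-1), not assumed as a named fact.

What is PROVED (node IUTchII:Prop3.1(ii), the residual clause, in transport form):
* `constantMonoid_isConjStable_of_kummer` — "equipped with a natural conjugation action by
  `Π_X(M^Θ_*)`": the `Prop31Statements.constants_stable` clause of the statement file FOLLOWS from the
  `Π`-equivariance of `κ` (it was a free hypothesis `hcns` of `prop31Statements_of_val`);
* `mem_units_iff_of_kummer` — `M^×_TM(M^Θ_*)` (the field `units`, axiom `units_eq`) is exactly the image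
  of the unit group `M_TM(Π)^×` (the Kummer identification `M_TM(Π)^× ≅ M^×_TM` quoted above, on the
  `M^Θ_*`-side);
* `exists_constantMonoid_mulEquiv_MTM` / `mulEquiv_MTM_unique` — `Ψ_cns(M^Θ_*) ⥲ M_TM(Π_X(M^Θ_*))`, the
  UNIQUE isomorphism inverting `κ`;
* `exists_constantMonoid_mulEquiv_Otri` — **"naturally isomorphic to `O^▷_{F̄_v}` [cf. Example 1.8,
  (ii)]"**: an isomorphism `Ψ_cns(M^Θ_*) ⥲ O^⊳(G_v(M^Θ_*))` with the Example 1.8 (ii) output at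
  `G_v(M^Θ_*) = Π_X(M^Θ_*)/Δ`, PINNED (it is `(*TM⊳) ∘ κ⁻¹`, unique by `mulEquiv_Otri_unique`) and
  NATURAL = `Π_X(M^Θ_*)`-equivariant for the conjugation action on `Ψ_cns` and the action of
  `Π ↠ Π/Δ = G_v` on `O^⊳`;
* `exists_units_mulEquiv_Ounits` — on unit groups, `Ψ^×_cns(M^Θ_*) ⥲ O^×(G_v(M^Θ_*))` (Example 1.8 (iii)
  `(*×)`), pinned to `Units.map (*TM⊳)`;
* `constantMonoid_map_eq_of_kummer_natural` — "functorial algorithm": along an isomorphism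
  `Π ⥲ Π*` of isomorphs and any homomorphism of ambient modules intertwining the two Kummer maps with
  `mapMTM`, the constant monoid is carried onto the constant monoid.
Honest residue: the identification of the abstract Example 1.8 (ii) output `O^⊳(G)` with the literal
multiplicative monoid `O^▷_{F̄_v}` of the MLF `F_v` is abc-iut-L4-t2/L4-t3's merge of `AbsTopMonoids`
([AbsTopIII] Def 3.1 (vi), Prop 5.8 (i)); the "inverse image of `ℤ ⊆ Ẑ`" sentence (Remark 1.11.5 (i),
`ValuationSurjection.kummer_range`) characterises the image of `κ` on `F_v^×` group-theoretically and
is not needed for the isomorphism class proved here.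
-/

namespace Literature.IUT.HodgeArakelov

namespace TemperedThetaMonoids

open CategoryTheory

universe u v w

/-! ### 0. Mechanism: a monoid embedded in a group by an injective homomorphism -/

section Mechanism

variable {M : Type u} {N : Type v} [CommMonoid M] [CommGroup N]

/-- The range restriction of an injective monoid homomorphism is bijective (so the source is
isomorphic to the image; the mechanism of "`Ψ_cns(M^Θ_*) := M_TM(M^Θ_*)` … naturally isomorphic to"
its source). [folklore] -/
private theorem mrangeRestrict_bijective_of_injective (f : M →* N) (hf : Function.Injective f) :
    Function.Bijective f.mrangeRestrict :=
  ⟨fun a b h => hf (by simpa using congrArg Subtype.val h), f.mrangeRestrict_surjective⟩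

/-- Inside a group, an element of the image of an injective monoid homomorphism `f : M →* N` is
invertible INSIDE THE IMAGE iff it is the image of a unit of `M` (the mechanism of
"`M^×_TM(M^Θ_*)` = the units of `M_TM(M^Θ_*)` = the image of `M_TM(Π)^×`"). [folklore] -/
private theorem mem_mrange_and_inv_mem_iff (f : M →* N) (hf : Function.Injective f) (x : N) :
    (x ∈ MonoidHom.mrange f ∧ x⁻¹ ∈ MonoidHom.mrange f) ↔ ∃ u : Mˣ, f (u : M) = x := by
  constructor
  · rintro ⟨⟨m, rfl⟩, ⟨m', hm'⟩⟩
    have h1 : m * m' = 1 := hf (by rw [map_mul, hm', mul_inv_cancel, map_one])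
    exact ⟨Units.mkOfMulEqOne m m' h1, rfl⟩
  · rintro ⟨u, rfl⟩
    exact ⟨⟨(u : M), rfl⟩, ⟨((u⁻¹ : Mˣ) : M), by rw [map_units_inv]⟩⟩

end Mechanism

/-! ### 1. Proposition 3.1 (ii): `Ψ_cns(M^Θ_*) = M_TM(M^Θ_*)` versus `M_TM(Π_X(M^Θ_*))` and `O^⊳(G_v(M^Θ_*))` -/

section Prop31ii

variable {S : ThetaSetting.{u}} (A : AbsTopMonoids S) (Pc : IsoClass S.PiX)
variable (E : ThetaEnvData.{u, v} Pc.G) (κ : A.MTM Pc →* E.H)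

/-- **IUTchII:Prop3.1(ii)** (kurims p.88) "equipped with a natural conjugation action by `Π_X(M^Θ_*)`":
if the Kummer map `κ : M_TM(Π_X(M^Θ_*)) → lim_J H¹(Π_Ÿ(M^Θ_*)|_J, Π_μ(M^Θ_*))` (after the cyclotomic
rigidity isomorphisms of Cors 2.8 (i), 2.9) is `Π_X(M^Θ_*)`-equivariant and `Ψ_cns(M^Θ_*)` is its image,
then `Ψ_cns(M^Θ_*)` is stable under the conjugation action — the clause
`Prop31Statements.constants_stable` of the statement file, derived rather than assumed.
[cite: Mochizuki2012, Prop 3.1 (ii) p.88] -/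
theorem constantMonoid_isConjStable_of_kummer (hcns : E.constantMonoid = MonoidHom.mrange κ)
    (hκeq : ∀ (x : Pc.G) (m : A.MTM Pc), κ (A.actMTM Pc x m) = E.conj x (κ m)) :
    E.IsConjStable E.constantMonoid := by
  intro g x hx
  rw [hcns] at hx ⊢
  obtain ⟨m, rfl⟩ := hx
  exact ⟨A.actMTM Pc g m, hκeq g m⟩

/-- **IUTchII:Prop3.1(ii)** (kurims p.88), consequence for (i): under the same hypotheses the unit group
`M^×_TM(M^Θ_*)` is stable under the conjugation action (so the collections `{Ψ^ι_env}_ι` of (i) carry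
the action as soon as the `θ^ι_env` are permuted — `conj_permutes_of_thetaEnv`).
[cite: Mochizuki2012, Prop 3.1 (ii) p.88] -/
theorem units_conjStable_of_kummer (hcns : E.constantMonoid = MonoidHom.mrange κ)
    (hκeq : ∀ (x : Pc.G) (m : A.MTM Pc), κ (A.actMTM Pc x m) = E.conj x (κ m)) :
    ∀ (g : Pc.G) (x : E.H), x ∈ E.units → E.conj g x ∈ E.units :=
  units_conjStable_of_constants E (constantMonoid_isConjStable_of_kummer A Pc E κ hcns hκeq)

/-- **IUTchII:Prop3.1(ii)** (kurims p.88) `M^×_TM(M^Θ_*) ⊆ M_TM(M^Θ_*) = Ψ_cns(M^Θ_*)`: the unit group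
`M^×_TM(M^Θ_*)` of the constant monoid (the statement file's `units`, axiom `units_eq`) is exactly the
image under the injective Kummer map of the group of units of `M_TM(Π_X(M^Θ_*))` — the `M^Θ_*`-side of
the Kummer identification `M_TM(Π)^× ≅ M^×_TM(Π)` ([AbsTopIII] Prop 3.2; Example 1.8 (iii) `(*×)`).
[cite: Mochizuki2012, Prop 3.1 (ii) p.88] -/
theorem mem_units_iff_of_kummer (hκ : Function.Injective κ)
    (hcns : E.constantMonoid = MonoidHom.mrange κ) (x : E.H) :
    x ∈ E.units ↔ ∃ u : (A.MTM Pc)ˣ, κ (u : A.MTM Pc) = x := by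
  rw [E.units_eq x, ← mem_mrange_and_inv_mem_iff κ hκ x, ← hcns]
  rfl

/-- **IUTchII:Prop3.1(ii)** (kurims p.88) `Ψ_cns(M^Θ_*) := M_TM(M^Θ_*)`: the constant monoid is
isomorphic to the [AbsTopIII] monoid `M_TM(Π_X(M^Θ_*))` of Example 1.8 (ii) by an isomorphism INVERTING
the Kummer map (both pinning equations). [cite: Mochizuki2012, Prop 3.1 (ii) p.88] -/
theorem exists_constantMonoid_mulEquiv_MTM (hκ : Function.Injective κ)
    (hcns : E.constantMonoid = MonoidHom.mrange κ) :
    ∃ e : E.constantMonoid ≃* A.MTM Pc,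
      (∀ c : E.constantMonoid, κ (e c) = (c : E.H)) ∧
      ∀ (m : A.MTM Pc) (hm : κ m ∈ E.constantMonoid), e ⟨κ m, hm⟩ = m := by
  let e₀ : A.MTM Pc ≃* MonoidHom.mrange κ :=
    MulEquiv.ofBijective κ.mrangeRestrict (mrangeRestrict_bijective_of_injective κ hκ)
  refine ⟨(MulEquiv.submonoidCongr hcns).trans e₀.symm, fun c => ?_, fun m hm => ?_⟩
  · show ((κ.mrangeRestrict (e₀.symm (MulEquiv.submonoidCongr hcns c)) : MonoidHom.mrange κ) : E.H) =
      ((MulEquiv.submonoidCongr hcns c : MonoidHom.mrange κ) : E.H)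
    exact congrArg Subtype.val
      (MulEquiv.ofBijective_apply_symm_apply (n := MulEquiv.submonoidCongr hcns c) κ.mrangeRestrict
        (mrangeRestrict_bijective_of_injective κ hκ))
  · rw [MulEquiv.trans_apply, MulEquiv.symm_apply_eq]
    exact Subtype.ext rfl

/-- **IUTchII:Prop3.1(ii)** (kurims p.88), uniqueness: an isomorphism `Ψ_cns(M^Θ_*) ⥲ M_TM(Π_X(M^Θ_*))`
inverting the (injective) Kummer map is unique — so "the" natural isomorphism of the printed clause is
a determined object, not a choice. [cite: Mochizuki2012, Prop 3.1 (ii) p.88] -/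
theorem mulEquiv_MTM_unique (hκ : Function.Injective κ) (e e' : E.constantMonoid ≃* A.MTM Pc)
    (he : ∀ c : E.constantMonoid, κ (e c) = (c : E.H))
    (he' : ∀ c : E.constantMonoid, κ (e' c) = (c : E.H)) : e = e' :=
  MulEquiv.ext fun c => hκ ((he c).trans (he' c).symm)

/-- **IUTchII:Prop3.1(ii)** (kurims p.88) **"a 'monoid of constants' — i.e., which is naturally
isomorphic to `O^▷_{F̄_v}` [cf. Example 1.8, (ii)] — equipped with a natural conjugation action by
`Π_X(M^Θ_*)`"**, DISCHARGED in transport form: composing the inverse of the Kummer map with the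
tautological isomorphism `(*TM⊳) (Π ↷ M_TM(Π)) ⥲ (Π/Δ ↷ O^⊳(Π/Δ))|_Π` of Example 1.8 (ii) gives an
isomorphism of `Ψ_cns(M^Θ_*)` with the Example 1.8 (ii) output `O^⊳(G_v(M^Θ_*))` at the arithmetic
quotient `G_v(M^Θ_*) = Π_X(M^Θ_*)/Δ` (recorded there as "isomorphic to the MLF-Galois TM-pair determined
by the natural action of `G_k` on … `O^▷_{k̄}`", `k = F_v`), which is (a) PINNED: on a Kummer class
`κ(m)` it is `(*TM⊳)(m)`, and (b) NATURAL: it intertwines the conjugation action of `x ∈ Π_X(M^Θ_*)` on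
`Ψ_cns(M^Θ_*)` with the action of the image of `x` in `G_v(M^Θ_*)` on `O^⊳`.
[cite: Mochizuki2012, Prop 3.1 (ii) p.88] -/
theorem exists_constantMonoid_mulEquiv_Otri (hκ : Function.Injective κ)
    (hcns : E.constantMonoid = MonoidHom.mrange κ)
    (hκeq : ∀ (x : Pc.G) (m : A.MTM Pc), κ (A.actMTM Pc x m) = E.conj x (κ m)) :
    ∃ e : E.constantMonoid ≃* A.Otri ⟨TopGroup.quot Pc.G (A.Delta Pc), A.quotIso Pc⟩,
      (∀ (m : A.MTM Pc) (hm : κ m ∈ E.constantMonoid), e ⟨κ m, hm⟩ = A.tauto Pc m) ∧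
      ∀ (x : Pc.G) (c : E.constantMonoid),
        e ⟨E.conj x c, constantMonoid_isConjStable_of_kummer A Pc E κ hcns hκeq x c c.2⟩ =
          A.actOtri ⟨TopGroup.quot Pc.G (A.Delta Pc), A.quotIso Pc⟩ (QuotientGroup.mk x) (e c) := by
  obtain ⟨e, he, he'⟩ := exists_constantMonoid_mulEquiv_MTM A Pc E κ hκ hcns
  refine ⟨e.trans (A.tauto Pc), fun m hm => by rw [MulEquiv.trans_apply, he' m hm], fun x c => ?_⟩
  have hc : (c : E.H) = κ (e c) := (he c).symm
  have hmem : κ (A.actMTM Pc x (e c)) ∈ E.constantMonoid :=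
    (SetLike.ext_iff.mp hcns _).mpr ⟨A.actMTM Pc x (e c), rfl⟩
  have hconj : (⟨E.conj x c, constantMonoid_isConjStable_of_kummer A Pc E κ hcns hκeq x c c.2⟩ :
      E.constantMonoid) = ⟨κ (A.actMTM Pc x (e c)), hmem⟩ := by
    apply Subtype.ext
    change E.conj x (c : E.H) = κ (A.actMTM Pc x (e c))
    rw [hκeq, ← hc]
  rw [hconj, MulEquiv.trans_apply, he' _ hmem, A.tauto_equivariant, MulEquiv.trans_apply]

/-- **IUTchII:Prop3.1(ii)** (kurims p.88), uniqueness of the natural isomorphism with `O^⊳`: an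
isomorphism `Ψ_cns(M^Θ_*) ⥲ O^⊳(G_v(M^Θ_*))` that is `(*TM⊳)` on Kummer classes is unique.
[cite: Mochizuki2012, Prop 3.1 (ii) p.88] -/
theorem mulEquiv_Otri_unique (hcns : E.constantMonoid = MonoidHom.mrange κ)
    (e e' : E.constantMonoid ≃* A.Otri ⟨TopGroup.quot Pc.G (A.Delta Pc), A.quotIso Pc⟩)
    (he : ∀ (m : A.MTM Pc) (hm : κ m ∈ E.constantMonoid), e ⟨κ m, hm⟩ = A.tauto Pc m)
    (he' : ∀ (m : A.MTM Pc) (hm : κ m ∈ E.constantMonoid), e' ⟨κ m, hm⟩ = A.tauto Pc m) : e = e' := by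
  refine MulEquiv.ext fun c => ?_
  have hc : (c : E.H) ∈ MonoidHom.mrange κ := (SetLike.ext_iff.mp hcns _).mp c.2
  obtain ⟨m, hm⟩ := hc
  have hcm : c = ⟨κ m, (SetLike.ext_iff.mp hcns _).mpr ⟨m, rfl⟩⟩ := Subtype.ext hm.symm
  rw [hcm, he, he']

/-- **IUTchII:Prop3.1(ii)** (kurims p.88) on unit groups (Example 1.8 (iii) `(*×)`, "the subgroups of
invertible elements"): `Ψ^×_cns(M^Θ_*) = M^×_TM(M^Θ_*) ⥲ O^×(G_v(M^Θ_*))`, pinned to `Units.map (*TM⊳)` on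
the images of the units of `M_TM(Π_X(M^Θ_*))` — the form in which the constant monoid's units enter
Corollaries 3.5–3.6 (`Ψ^×_cns`, the unit diagonal) and Definition 4.9 (`×`-Kummer structures).
[cite: Mochizuki2012, Prop 3.1 (ii) p.88] -/
theorem exists_units_mulEquiv_Ounits (hκ : Function.Injective κ)
    (hcns : E.constantMonoid = MonoidHom.mrange κ) :
    ∃ eu : E.units ≃* A.Ounits ⟨TopGroup.quot Pc.G (A.Delta Pc), A.quotIso Pc⟩,
      ∀ (u : (A.MTM Pc)ˣ) (hu : κ (u : A.MTM Pc) ∈ E.units),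
        eu ⟨κ (u : A.MTM Pc), hu⟩ = Units.map (A.tauto Pc).toMonoidHom u := by
  have hmem : ∀ u : (A.MTM Pc)ˣ, κ (u : A.MTM Pc) ∈ E.units := fun u =>
    (mem_units_iff_of_kummer A Pc E κ hκ hcns _).mpr ⟨u, rfl⟩
  let f : (A.MTM Pc)ˣ →* E.units :=
    MonoidHom.codRestrict (κ.comp (Units.coeHom (A.MTM Pc))) E.units fun u => hmem u
  have hf : Function.Bijective f := by
    constructor
    · intro a b h
      exact Units.ext (hκ (by simpa [f] using congrArg Subtype.val h))
    · intro x
      obtain ⟨u, hu⟩ := (mem_units_iff_of_kummer A Pc E κ hκ hcns (x : E.H)).mp x.2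
      exact ⟨u, Subtype.ext (by simpa [f] using hu)⟩
  refine ⟨(MulEquiv.ofBijective f hf).symm.trans (Units.mapEquiv (A.tauto Pc)), fun u hu => ?_⟩
  have hx : (⟨κ (u : A.MTM Pc), hu⟩ : E.units) = MulEquiv.ofBijective f hf u := Subtype.ext rfl
  rw [MulEquiv.trans_apply, hx, MulEquiv.symm_apply_apply]
  rfl

end Prop31ii

/-! ### 2. "functorial algorithm `M^Θ_* ↦ Ψ_cns(M^Θ_*)`" -/

section Functorial

variable {S : ThetaSetting.{u}} (A : AbsTopMonoids S) {Pc Qc : IsoClass S.PiX}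
variable (E : ThetaEnvData.{u, v} Pc.G) (E' : ThetaEnvData.{u, w} Qc.G)
variable (κ : A.MTM Pc →* E.H) (κ' : A.MTM Qc →* E'.H)

/-- **IUTchII:Prop3.1(ii)** (kurims p.88) "one obtains a functorial algorithm `M^Θ_* ↦ Ψ_cns(M^Θ_*)`": for
an isomorphism `f : Π_X(M^Θ_*) ⥲ Π_X(M'^Θ_*)` of isomorphs of `Π^tp_{X̲̲_k}` (inducing
`M_TM(f) : M_TM(Π_X(M^Θ_*)) ⥲ M_TM(Π_X(M'^Θ_*))`, `AbsTopMonoids.mapMTM`) and any homomorphism `φ` of the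
ambient cohomology modules compatible with the two Kummer maps, `φ` carries `Ψ_cns(M^Θ_*)` ONTO
`Ψ_cns(M'^Θ_*)`. [cite: Mochizuki2012, Prop 3.1 (ii) p.88] -/
theorem constantMonoid_map_eq_of_kummer_natural (f : Pc ⟶ Qc) (φ : E.H →* E'.H)
    (hφ : ∀ m : A.MTM Pc, φ (κ m) = κ' (A.mapMTM f m))
    (hcns : E.constantMonoid = MonoidHom.mrange κ) (hcns' : E'.constantMonoid = MonoidHom.mrange κ') :
    E.constantMonoid.map φ = E'.constantMonoid := by
  rw [hcns, hcns', MonoidHom.map_mrange]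
  ext y
  simp only [MonoidHom.mem_mrange, MonoidHom.coe_comp, Function.comp_apply]
  constructor
  · rintro ⟨m, rfl⟩
    exact ⟨A.mapMTM f m, (hφ m).symm⟩
  · rintro ⟨m', rfl⟩
    refine ⟨(A.mapMTM f).symm m', ?_⟩
    rw [hφ, MulEquiv.apply_symm_apply]

end Functorial

end TemperedThetaMonoids

end Literature.IUT.HodgeArakelov
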